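import Summits.ValiantsHypothesis.ValiantsHypothesis.Theorems.KPlusLogSqLawStaticTridiagonalSmallSizes

/-!
# THREE-BY-THREE LAW for ALL static definite tridiagonal designs: at most TWO positive determinant zeros (Part 5)

HONEST FRAMING.  Helper theorems (`--supports stmt-ValiantsHypothesis-19561 --as helper`; seat val-sym-lift-p2 g9, cell
`pub-symmetroid`, 2026-08-27) on the REAL side of the desk's typed α target (lead R2102/R2114).  Part 4
(`…StaticTridiagonalSmallSizes`) proved `Z ≤ 2` for IRREDUCIBLE `3 × 3` designs from the bottom-class law; this file removes the
irreducibility hypothesis: **every** real symmetric tridiagonal `3 × 3` matrix of monomials with positive diagonal coefficients has at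
most two distinct positive determinant zeros (the located and paper value `m − 1 = 2` — the first all-designs kernel upper row of the
sector at a size `≥ 3`).  A vanishing link coefficient splits the continuant and puts every zero on a MONOMIAL EQUATION
`α t^u = β t^v` (`α > 0`), which has at most one positive solution unless it is an identity (and then the determinant vanishes
identically and has no roots in the `roots.toFinset` count).  Calibration row; nothing here bears on `WeakLifting` (stmt-19561) /
`TropicalB` (stmt-19771) in their windows, Conjecture B, the Door-A registers, `MatrixDescartes` (stmt-ValiantsHypothesis-18050) or VP ≠ VNP.

WHAT IS PROVED.
1. `monomialEq_forall_of_two` — `α t^u = β t^v` (`α > 0`) at two distinct positive points forces `u = v`, `α = β` (so it holds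
   everywhere); `card_filter_monomialEq_le_one` — hence among the positive roots of a polynomial at most ONE lies on such a branch when the
   branch consists of roots.
2. `det_design_rev` — reading the design backwards (`i ↦ rev i`) does not change the determinant polynomial; `isRoot_iff_ctK_eq_zero` —
   roots are zeros of the `m`-th continuant (bookkeeping over Part 2).
3. **`card_posRoots_three_le_two_all`** — the THREE-BY-THREE LAW for all designs (cases `c₁₂ = 0`; `c₀₁ = 0` by reversal; irreducible by Part 4).
[folklore: continuants; this seat's Parts 2–4.]
-/

set_option linter.dupNamespace false
set_option autoImplicit false

namespace Summit.ValiantsHypothesis.ValiantsHypothesis.Theorems.KPlusLogSqLaw.DefiniteInterpolation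

open Summit.ValiantsHypothesis.ValiantsHypothesis.Theorems.ValuativeFlip (ctK ctK_zero ctK_one ctK_two ctK_add_two)
open Polynomial

/-! ### Reducible designs of sizes 3 and 4: a vanishing link splits the continuant, and the zeros obey MONOMIAL EQUATIONS -/

section Reducible

/-- **Monomial equations have at most one positive solution unless they are identities**: if `α t^u = β t^v` (`α > 0`) holds at
two distinct positive points then it holds at every real `t` (indeed `u = v` and `α = β`). [folklore] -/
theorem monomialEq_forall_of_two {α β t₁ t₂ : ℝ} {u v : ℕ} (hα : 0 < α) (h₁ : 0 < t₁) (h₂ : 0 < t₂) (hne : t₁ ≠ t₂)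
    (e₁ : α * t₁ ^ u = β * t₁ ^ v) (e₂ : α * t₂ ^ u = β * t₂ ^ v) : ∀ t : ℝ, α * t ^ u = β * t ^ v := by
  -- first `u = v`
  have key : ∀ {a b : ℕ} {γ δ : ℝ}, 0 < γ → a < b → γ * t₁ ^ a = δ * t₁ ^ b → γ * t₂ ^ a = δ * t₂ ^ b → False := by
    intro a b γ δ hγ hab f₁ f₂
    obtain ⟨d, rfl⟩ := Nat.exists_eq_add_of_lt hab
    have g₁ : γ = δ * t₁ ^ (d + 1) := by
      have : γ * t₁ ^ a = (δ * t₁ ^ (d + 1)) * t₁ ^ a := by rw [f₁]; ring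
      exact mul_right_cancel₀ (pow_ne_zero _ h₁.ne') this
    have g₂ : γ = δ * t₂ ^ (d + 1) := by
      have : γ * t₂ ^ a = (δ * t₂ ^ (d + 1)) * t₂ ^ a := by rw [f₂]; ring
      exact mul_right_cancel₀ (pow_ne_zero _ h₂.ne') this
    have hδ : 0 < δ := by
      by_contra hδ
      rw [not_lt] at hδ
      have : γ ≤ 0 := by rw [g₁]; exact mul_nonpos_of_nonpos_of_nonneg hδ (pow_nonneg h₁.le _)
      linarith
    have hpow : t₁ ^ (d + 1) = t₂ ^ (d + 1) := by
      have : δ * t₁ ^ (d + 1) = δ * t₂ ^ (d + 1) := by rw [← g₁, ← g₂]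
      exact mul_left_cancel₀ hδ.ne' this
    exact hne ((pow_left_inj₀ h₁.le h₂.le (Nat.succ_ne_zero d)).mp hpow)
  have huv : u = v := by
    rcases Nat.lt_trichotomy u v with h | h | h
    · exact (key hα h e₁ e₂).elim
    · exact h
    · -- swap the roles: β t^v = α t^u with β > 0
      have hβ : 0 < β := by
        have : 0 < β * t₁ ^ v := by rw [← e₁]; exact mul_pos hα (pow_pos h₁ _)
        exact pos_of_mul_pos_left this (pow_nonneg h₁.le _)
      exact (key hβ h e₁.symm e₂.symm).elim
  subst huv
  have hαβ : α = β := mul_right_cancel₀ (pow_ne_zero _ h₁.ne') e₁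
  subst hαβ
  intro t; rfl

/-- **At most one positive root on a monomial-equation branch**: if every positive solution of `α t^u = β t^v` (`α > 0`) is a root
of the polynomial `P`, then among the positive roots of `P` at most ONE satisfies the equation (two would make the equation an identity,
hence `P = 0`, which has no roots). [this file] -/
theorem card_filter_monomialEq_le_one (P : ℝ[X]) {α β : ℝ} {u v : ℕ} (hα : 0 < α)
    (himp : ∀ t : ℝ, 0 < t → α * t ^ u = β * t ^ v → P.IsRoot t) :
    ((P.roots.toFinset.filter (fun t : ℝ => 0 < t)).filter (fun t : ℝ => α * t ^ u = β * t ^ v)).card ≤ 1 := by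
  by_contra hcard
  rw [not_le, Finset.one_lt_card_iff] at hcard
  obtain ⟨t₁, t₂, ht₁, ht₂, hne⟩ := hcard
  rw [Finset.mem_filter, Finset.mem_filter, Multiset.mem_toFinset, Polynomial.mem_roots'] at ht₁ ht₂
  obtain ⟨⟨⟨hP0, -⟩, h₁⟩, e₁⟩ := ht₁
  obtain ⟨⟨⟨-, -⟩, h₂⟩, e₂⟩ := ht₂
  have hall := monomialEq_forall_of_two hα h₁ h₂ hne e₁ e₂
  apply hP0
  apply Polynomial.eq_zero_of_infinite_isRoot
  exact Set.Infinite.mono (fun t (ht : t ∈ Set.Ioi (0 : ℝ)) => himp t ht (hall t)) (Set.Ioi_infinite 0)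

variable {m : ℕ} (c : Fin m → Fin m → ℝ) (e : Fin m → Fin m → ℕ)

/-- **Reversal symmetry**: the design read backwards (`i ↦ rev i`) has the same determinant polynomial. [folklore] -/
theorem det_design_rev :
    Matrix.det (Matrix.of fun i j : Fin m => C (c (Fin.rev i) (Fin.rev j)) * (X : ℝ[X]) ^ e (Fin.rev i) (Fin.rev j)) =
      Matrix.det (Matrix.of fun i j : Fin m => C (c i j) * (X : ℝ[X]) ^ e i j) := by
  rw [← Matrix.det_submatrix_equiv_self Fin.revPerm (Matrix.of fun i j : Fin m => C (c i j) * (X : ℝ[X]) ^ e i j)]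
  rfl

/-- A positive root of the determinant is a zero of the `m`-th continuant and conversely (bookkeeping). [this file] -/
theorem isRoot_iff_ctK_eq_zero (hband : ∀ i j : Fin m, (i : ℕ) + 1 < j ∨ (j : ℕ) + 1 < i → c i j = 0) (t : ℝ) :
    (Matrix.det (Matrix.of fun i j => C (c i j) * (X : ℝ[X]) ^ e i j)).IsRoot t ↔
      ctK (fun s : ℕ => if h : s < m then c ⟨s, h⟩ ⟨s, h⟩ * t ^ e ⟨s, h⟩ ⟨s, h⟩ else 1)
        (fun s : ℕ => -(if h : s + 1 < m then c ⟨s, by omega⟩ ⟨s + 1, h⟩ * t ^ e ⟨s, by omega⟩ ⟨s + 1, h⟩ else 0))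
        (fun s : ℕ => if h : 1 ≤ s ∧ s < m then c ⟨s, h.2⟩ ⟨s - 1, by omega⟩ * t ^ e ⟨s, h.2⟩ ⟨s - 1, by omega⟩ else 0) m = 0 := by
  rw [Polynomial.IsRoot.def, eval_det_design c e t, det_design_eq_ctK c e hband t]

/-- **THREE-BY-THREE LAW (all designs): every static definite tridiagonal `3 × 3` design has at most TWO positive determinant zeros**
(sharp).  Irreducible: `card_posRoots_three_le_two`; a vanishing link `c₁₂ = 0` forces every positive zero onto the monomial equation
`c₀₀c₁₁ t^(e₀₀+e₁₁) = c₀₁c₁₀ t^(e₀₁+e₁₀)` (at most one solution unless the determinant vanishes identically); `c₀₁ = 0` is the same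
after reversal. [this file] -/
theorem card_posRoots_three_le_two_all (c : Fin 3 → Fin 3 → ℝ) (e : Fin 3 → Fin 3 → ℕ) (hc : ∀ i j, c i j = c j i)
    (hband : ∀ i j : Fin 3, (i : ℕ) + 1 < j ∨ (j : ℕ) + 1 < i → c i j = 0) (hpos : ∀ i, 0 < c i i) :
    ((Matrix.det (Matrix.of fun i j => C (c i j) * (X : ℝ[X]) ^ e i j)).roots.toFinset.filter
      (fun t : ℝ => 0 < t)).card ≤ 2 := by
  -- the case `c₁₂ = 0`, for an arbitrary design `c'` of size 3
  have hlink : ∀ (c' : Fin 3 → Fin 3 → ℝ) (e' : Fin 3 → Fin 3 → ℕ), (∀ i j, c' i j = c' j i) →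
      (∀ i j : Fin 3, (i : ℕ) + 1 < j ∨ (j : ℕ) + 1 < i → c' i j = 0) → (∀ i, 0 < c' i i) →
      c' ⟨1, by omega⟩ ⟨2, by omega⟩ = 0 →
      ((Matrix.det (Matrix.of fun i j => C (c' i j) * (X : ℝ[X]) ^ e' i j)).roots.toFinset.filter
        (fun t : ℝ => 0 < t)).card ≤ 2 := by
    intro c' e' hc' hband' hpos' h12
    set P := Matrix.det (Matrix.of fun i j => C (c' i j) * (X : ℝ[X]) ^ e' i j) with hP
    -- every positive root satisfies `α t^u = β t^v`
    have hroots : ∀ t : ℝ, 0 < t → (P.IsRoot t ↔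
        (c' ⟨1, by omega⟩ ⟨1, by omega⟩ * c' ⟨0, by omega⟩ ⟨0, by omega⟩) *
            t ^ (e' ⟨1, by omega⟩ ⟨1, by omega⟩ + e' ⟨0, by omega⟩ ⟨0, by omega⟩) =
          (c' ⟨0, by omega⟩ ⟨1, by omega⟩ * c' ⟨1, by omega⟩ ⟨0, by omega⟩) *
            t ^ (e' ⟨0, by omega⟩ ⟨1, by omega⟩ + e' ⟨1, by omega⟩ ⟨0, by omega⟩)) := by
      intro t ht
      have hL : ∀ (s : ℕ) (hs : s < 3), (fun s : ℕ => if h : s < 3 then c' ⟨s, h⟩ ⟨s, h⟩ * t ^ e' ⟨s, h⟩ ⟨s, h⟩ else 1) s =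
          c' ⟨s, hs⟩ ⟨s, hs⟩ * t ^ e' ⟨s, hs⟩ ⟨s, hs⟩ := fun s hs => by simp only [dif_pos hs]
      have hMN : ∀ (s : ℕ) (hs : s + 1 < 3), (fun s : ℕ => -(if h : s + 1 < 3 then c' ⟨s, by omega⟩ ⟨s + 1, h⟩ * t ^ e' ⟨s, by omega⟩ ⟨s + 1, h⟩ else 0)) s *
          (fun s : ℕ => if h : 1 ≤ s ∧ s < 3 then c' ⟨s, h.2⟩ ⟨s - 1, by omega⟩ * t ^ e' ⟨s, h.2⟩ ⟨s - 1, by omega⟩ else 0) (s + 1) =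
          -(c' ⟨s, by omega⟩ ⟨s + 1, hs⟩ * c' ⟨s + 1, hs⟩ ⟨s, by omega⟩ *
            t ^ (e' ⟨s, by omega⟩ ⟨s + 1, hs⟩ + e' ⟨s + 1, hs⟩ ⟨s, by omega⟩)) := by
        intro s hs
        have hw := linkWeight_eq c' e' t s
        rw [dif_pos hs] at hw
        linarith
      have h3 : ctK (fun s : ℕ => if h : s < 3 then c' ⟨s, h⟩ ⟨s, h⟩ * t ^ e' ⟨s, h⟩ ⟨s, h⟩ else 1)
          (fun s : ℕ => -(if h : s + 1 < 3 then c' ⟨s, by omega⟩ ⟨s + 1, h⟩ * t ^ e' ⟨s, by omega⟩ ⟨s + 1, h⟩ else 0))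
          (fun s : ℕ => if h : 1 ≤ s ∧ s < 3 then c' ⟨s, h.2⟩ ⟨s - 1, by omega⟩ * t ^ e' ⟨s, h.2⟩ ⟨s - 1, by omega⟩ else 0) 3 =
          (fun s : ℕ => if h : s < 3 then c' ⟨s, h⟩ ⟨s, h⟩ * t ^ e' ⟨s, h⟩ ⟨s, h⟩ else 1) 2 *
            ctK (fun s : ℕ => if h : s < 3 then c' ⟨s, h⟩ ⟨s, h⟩ * t ^ e' ⟨s, h⟩ ⟨s, h⟩ else 1)
          (fun s : ℕ => -(if h : s + 1 < 3 then c' ⟨s, by omega⟩ ⟨s + 1, h⟩ * t ^ e' ⟨s, by omega⟩ ⟨s + 1, h⟩ else 0))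
          (fun s : ℕ => if h : 1 ≤ s ∧ s < 3 then c' ⟨s, h.2⟩ ⟨s - 1, by omega⟩ * t ^ e' ⟨s, h.2⟩ ⟨s - 1, by omega⟩ else 0) 2 +
          (fun s : ℕ => -(if h : s + 1 < 3 then c' ⟨s, by omega⟩ ⟨s + 1, h⟩ * t ^ e' ⟨s, by omega⟩ ⟨s + 1, h⟩ else 0)) 1 *
            (fun s : ℕ => if h : 1 ≤ s ∧ s < 3 then c' ⟨s, h.2⟩ ⟨s - 1, by omega⟩ * t ^ e' ⟨s, h.2⟩ ⟨s - 1, by omega⟩ else 0) (1 + 1) *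
            ctK (fun s : ℕ => if h : s < 3 then c' ⟨s, h⟩ ⟨s, h⟩ * t ^ e' ⟨s, h⟩ ⟨s, h⟩ else 1)
          (fun s : ℕ => -(if h : s + 1 < 3 then c' ⟨s, by omega⟩ ⟨s + 1, h⟩ * t ^ e' ⟨s, by omega⟩ ⟨s + 1, h⟩ else 0))
          (fun s : ℕ => if h : 1 ≤ s ∧ s < 3 then c' ⟨s, h.2⟩ ⟨s - 1, by omega⟩ * t ^ e' ⟨s, h.2⟩ ⟨s - 1, by omega⟩ else 0) 1 := ctK_add_two _ _ _ 1
      have h2 : ctK (fun s : ℕ => if h : s < 3 then c' ⟨s, h⟩ ⟨s, h⟩ * t ^ e' ⟨s, h⟩ ⟨s, h⟩ else 1)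
          (fun s : ℕ => -(if h : s + 1 < 3 then c' ⟨s, by omega⟩ ⟨s + 1, h⟩ * t ^ e' ⟨s, by omega⟩ ⟨s + 1, h⟩ else 0))
          (fun s : ℕ => if h : 1 ≤ s ∧ s < 3 then c' ⟨s, h.2⟩ ⟨s - 1, by omega⟩ * t ^ e' ⟨s, h.2⟩ ⟨s - 1, by omega⟩ else 0) 2 =
          (fun s : ℕ => if h : s < 3 then c' ⟨s, h⟩ ⟨s, h⟩ * t ^ e' ⟨s, h⟩ ⟨s, h⟩ else 1) 1 *
            (fun s : ℕ => if h : s < 3 then c' ⟨s, h⟩ ⟨s, h⟩ * t ^ e' ⟨s, h⟩ ⟨s, h⟩ else 1) 0 +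
          (fun s : ℕ => -(if h : s + 1 < 3 then c' ⟨s, by omega⟩ ⟨s + 1, h⟩ * t ^ e' ⟨s, by omega⟩ ⟨s + 1, h⟩ else 0)) 0 *
            (fun s : ℕ => if h : 1 ≤ s ∧ s < 3 then c' ⟨s, h.2⟩ ⟨s - 1, by omega⟩ * t ^ e' ⟨s, h.2⟩ ⟨s - 1, by omega⟩ else 0) 1 :=
        ctK_two _ _ _
      have h1 : ctK (fun s : ℕ => if h : s < 3 then c' ⟨s, h⟩ ⟨s, h⟩ * t ^ e' ⟨s, h⟩ ⟨s, h⟩ else 1)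
          (fun s : ℕ => -(if h : s + 1 < 3 then c' ⟨s, by omega⟩ ⟨s + 1, h⟩ * t ^ e' ⟨s, by omega⟩ ⟨s + 1, h⟩ else 0))
          (fun s : ℕ => if h : 1 ≤ s ∧ s < 3 then c' ⟨s, h.2⟩ ⟨s - 1, by omega⟩ * t ^ e' ⟨s, h.2⟩ ⟨s - 1, by omega⟩ else 0) 1 =
          (fun s : ℕ => if h : s < 3 then c' ⟨s, h⟩ ⟨s, h⟩ * t ^ e' ⟨s, h⟩ ⟨s, h⟩ else 1) 0 := ctK_one _ _ _
      have h12' : c' ⟨1, by omega⟩ ⟨1 + 1, by omega⟩ = 0 := h12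
      rw [hP, isRoot_iff_ctK_eq_zero c' e' hband' t, h3, h2, h1, hMN 1 (by omega), hMN 0 (by omega), hL 2 (by omega),
        hL 1 (by omega), hL 0 (by omega), h12']
      have hA : 0 < c' ⟨2, by omega⟩ ⟨2, by omega⟩ * t ^ e' ⟨2, by omega⟩ ⟨2, by omega⟩ := mul_pos (hpos' _) (pow_pos ht _)
      have hαu : c' ⟨1, by omega⟩ ⟨1, by omega⟩ * c' ⟨0, by omega⟩ ⟨0, by omega⟩ *
            t ^ (e' ⟨1, by omega⟩ ⟨1, by omega⟩ + e' ⟨0, by omega⟩ ⟨0, by omega⟩) =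
          c' ⟨1, by omega⟩ ⟨1, by omega⟩ * t ^ e' ⟨1, by omega⟩ ⟨1, by omega⟩ *
            (c' ⟨0, by omega⟩ ⟨0, by omega⟩ * t ^ e' ⟨0, by omega⟩ ⟨0, by omega⟩) := by ring
      have hβv : c' ⟨0, by omega⟩ ⟨1, by omega⟩ * c' ⟨1, by omega⟩ ⟨0, by omega⟩ *
            t ^ (e' ⟨0, by omega⟩ ⟨1, by omega⟩ + e' ⟨1, by omega⟩ ⟨0, by omega⟩) =
          c' ⟨0, by omega⟩ ⟨0 + 1, by omega⟩ * c' ⟨0 + 1, by omega⟩ ⟨0, by omega⟩ *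
            t ^ (e' ⟨0, by omega⟩ ⟨0 + 1, by omega⟩ + e' ⟨0 + 1, by omega⟩ ⟨0, by omega⟩) := rfl
      rw [hαu, hβv]
      constructor
      · intro h
        have hprod : c' ⟨2, by omega⟩ ⟨2, by omega⟩ * t ^ e' ⟨2, by omega⟩ ⟨2, by omega⟩ *
            (c' ⟨1, by omega⟩ ⟨1, by omega⟩ * t ^ e' ⟨1, by omega⟩ ⟨1, by omega⟩ *
              (c' ⟨0, by omega⟩ ⟨0, by omega⟩ * t ^ e' ⟨0, by omega⟩ ⟨0, by omega⟩) +
            -(c' ⟨0, by omega⟩ ⟨0 + 1, by omega⟩ * c' ⟨0 + 1, by omega⟩ ⟨0, by omega⟩ *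
              t ^ (e' ⟨0, by omega⟩ ⟨0 + 1, by omega⟩ + e' ⟨0 + 1, by omega⟩ ⟨0, by omega⟩))) = 0 := by
          linarith
        rcases mul_eq_zero.mp hprod with h0 | h0
        · exact absurd h0 hA.ne'
        · linarith
      · intro h
        have hB : c' ⟨1, by omega⟩ ⟨1, by omega⟩ * t ^ e' ⟨1, by omega⟩ ⟨1, by omega⟩ *
              (c' ⟨0, by omega⟩ ⟨0, by omega⟩ * t ^ e' ⟨0, by omega⟩ ⟨0, by omega⟩) +
            -(c' ⟨0, by omega⟩ ⟨0 + 1, by omega⟩ * c' ⟨0 + 1, by omega⟩ ⟨0, by omega⟩ *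
              t ^ (e' ⟨0, by omega⟩ ⟨0 + 1, by omega⟩ + e' ⟨0 + 1, by omega⟩ ⟨0, by omega⟩)) = 0 := by
          linarith
        rw [hB]
        ring
    have hα : 0 < c' ⟨1, by omega⟩ ⟨1, by omega⟩ * c' ⟨0, by omega⟩ ⟨0, by omega⟩ := mul_pos (hpos' _) (hpos' _)
    have hsub : P.roots.toFinset.filter (fun t : ℝ => 0 < t) ⊆
        (P.roots.toFinset.filter (fun t : ℝ => 0 < t)).filter (fun t : ℝ =>
          (c' ⟨1, by omega⟩ ⟨1, by omega⟩ * c' ⟨0, by omega⟩ ⟨0, by omega⟩) *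
              t ^ (e' ⟨1, by omega⟩ ⟨1, by omega⟩ + e' ⟨0, by omega⟩ ⟨0, by omega⟩) =
            (c' ⟨0, by omega⟩ ⟨1, by omega⟩ * c' ⟨1, by omega⟩ ⟨0, by omega⟩) *
              t ^ (e' ⟨0, by omega⟩ ⟨1, by omega⟩ + e' ⟨1, by omega⟩ ⟨0, by omega⟩)) := by
      intro t ht
      rw [Finset.mem_filter]
      refine ⟨ht, ?_⟩
      rw [Finset.mem_filter, Multiset.mem_toFinset, Polynomial.mem_roots'] at ht
      exact (hroots t ht.2).mp ht.1.2
    exact le_trans (Finset.card_le_card hsub)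
      (le_trans (card_filter_monomialEq_le_one P hα (fun t ht h => (hroots t ht).mpr h)) (by norm_num))
  by_cases h12 : c ⟨1, by omega⟩ ⟨2, by omega⟩ = 0
  · exact hlink c e hc hband hpos h12
  by_cases h01 : c ⟨0, by omega⟩ ⟨1, by omega⟩ = 0
  · -- reverse the design: the link `(0,1)` becomes the link `(1,2)`
    rw [← det_design_rev c e]
    refine hlink (fun i j => c (Fin.rev i) (Fin.rev j)) (fun i j => e (Fin.rev i) (Fin.rev j)) (fun i j => hc _ _)
      (fun i j hij => hband _ _ ?_) (fun i => hpos _) ?_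
    · rcases hij with h | h
      · right; simp only [Fin.val_rev]; omega
      · left; simp only [Fin.val_rev]; omega
    · rw [hc]
      convert h01 using 2 <;> decide
  · exact card_posRoots_three_le_two c e hc hband hpos (fun k hk => by
      rcases Nat.lt_or_ge k 1 with h | h
      · obtain rfl : k = 0 := by omega
        exact h01
      · obtain rfl : k = 1 := by omega
        exact h12)


end Reducible

end Summit.ValiantsHypothesis.ValiantsHypothesis.Theorems.KPlusLogSqLaw.DefiniteInterpolation
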